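import Summits.RiemannHypothesis.RiemannHypothesis.Theorems.PfPersistenceF1BLExt

/-!
# PF persistence, fake seat 1 — the ANALYTIC HALF of BL-EXT(U) (FAKES §1.9, THEOREM F1-U)

Unit `pub-rhpf-fake-1` of the `pub-rhpf` cell (mechanism / rigidity campaign; **no RH claims**).

GAP F1-G-b″ (RULING A137) asks whether a `ζ`-dressed g-prime system honest below depth `U` can have a
spectral measure on the critical line other than `ζ`'s own (`BLExt U`, file `PfPersistenceF1BLExt`).
Membership factors through two conditions on the measure `μ`: (i) ANALYTIC — `μ` represents the same
quadratic form as `ζ`'s spectral measure `μ_Z` on Weil tests of small support (equivalently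
`μ̂ = μ̂_Z` on `(−log U, log U)`), and (ii) ARITHMETIC — the form it represents on ALL tests is that of
an honest g-prime system.  This file types condition (i) alone as the set `AnalyticBLExt U μZ` of
ANALYTIC TWINS of `μZ` below depth `U` and proves the bookkeeping around it (sorry-free):

* `blExt_subset_analyticBLExt`: granting a spectral measure `μZ` of `ζ`'s datum, `BLExt U ⊆ AnalyticBLExt U μZ`
  (an honest system's quadratic form agrees with `ζ`'s on tests `g` with `supp (g ⋆ g̃) ⊂ (−log U, log U)`);
* `self_mem_analyticBLExt`, `analyticBLExt_antitone`, and CONVEXITY (`convexComb_mem_analyticBLExt`):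
  the analytic half is a convex set containing `μZ`, antitone in the depth;
* the typed statement `AnalyticNonRigidity` of THEOREM F1-U (FAKES §1.9.1; THEOREM-informal, inputs
  de Branges 1968 Thms 22–23, Duffin–Schaeffer sampling at Beurling density, Littlewood's gap theorem;
  NOT proved here — de Branges spaces are not in Mathlib): for every `U > 1` the analytic half contains
  uncountably many members other than `μZ`.  Consequently the whole content of GAP F1-G-b″ is the
  arithmetic condition (ii) — recorded, not hidden.

Nothing about `ζ` is asserted: `μZ` enters only through the hypothesis `IsSpectralMeasure zetaC μZ`.
-/

set_option linter.dupNamespace false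

noncomputable section

open MeasureTheory Set Complex
open scoped ENNReal

namespace Summit.RiemannHypothesis.RiemannHypothesis.Theorems.PfPersistence.Fake1.AnalyticTwin

open Literature.NumberTheory.LFunctions
open Summit.RiemannHypothesis.RiemannHypothesis.Theorems.PfPersistenceBarrier
open Summit.RiemannHypothesis.RiemannHypothesis.Theorems.PfPersistenceBarrier.ExplicitDatum
open Summit.RiemannHypothesis.RiemannHypothesis.Theorems.PfPersistence.Fake1
open Summit.RiemannHypothesis.RiemannHypothesis.Theorems.PfPersistence.Fake1.BLExt

/-- `μ` is EVEN AND TEMPERED: invariant under `t ↦ −t`, finite on compacts with polynomial growth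
(the first two clauses of `IsSpectralMeasure`). (A problem-side notion of the campaign, FAKES §1.9.0;
not a Literature fact.) -/
def IsEvenTempered (μ : Measure ℝ) : Prop :=
  μ.map (fun t : ℝ => -t) = μ ∧
  ∃ C N : ℝ, ∀ T : ℝ, 0 ≤ T → μ (Icc (-T) T) ≠ ⊤ ∧ (μ (Icc (-T) T)).toReal ≤ C * (1 + T) ^ N

/-- `μ` is an ANALYTIC TWIN of `μZ` BELOW DEPTH `U`: for every Weil test `g` supported in `[-a, a]` with
`2a < log U`, `t ↦ ‖ĝ(1/2 + it)‖²` is `μ`-integrable and has the same integral against `μ` and `μZ`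
(condition (i) of GAP F1-G-b″ in Weil-test form; informally `μ̂ = μ̂_Z` on `(−log U, log U)`,
FAKES §1.9.2 (c)). (A problem-side notion; not a Literature fact.) -/
def AnalyticTwinBelow (U : ℝ) (μZ μ : Measure ℝ) : Prop :=
  ∀ g : ℝ → ℂ, IsWeilTest g → ∀ a : ℝ, tsupport g ⊆ Icc (-a) a → 2 * a < Real.log U →
    Integrable (fun t : ℝ => ‖weilMellin g (1 / 2 + t * I)‖ ^ 2) μ ∧
    ∫ t : ℝ, ‖weilMellin g (1 / 2 + t * I)‖ ^ 2 ∂μ = ∫ t : ℝ, ‖weilMellin g (1 / 2 + t * I)‖ ^ 2 ∂μZ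

/-- **ABL-EXT(U; μZ)**, the ANALYTIC HALF of BL-EXT(U) (FAKES §1.9.0): even tempered measures that are
analytic twins of `μZ` below depth `U`. (A problem-side carrier set; not a gap class, not a Literature
fact.) -/
def AnalyticBLExt (U : ℝ) (μZ : Measure ℝ) : Set (Measure ℝ) :=
  {μ | IsEvenTempered μ ∧ AnalyticTwinBelow U μZ μ}

/-- **THEOREM F1-U, typed** (FAKES §1.9.1 (U); THEOREM-informal with external inputs de Branges 1968
Thms 22–23, Duffin–Schaeffer / Jaffard sampling, Littlewood's gap theorem and `N(T)` asymptotics;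
statement only — NOT proved in the kernel): for every depth `U > 1` and every spectral measure `μZ` of
`ζ`'s datum, the analytic half of BL-EXT(U) contains an uncountable set of measures avoiding `μZ`.
(A `Prop`: statement only; not a Literature fact.) -/
def AnalyticNonRigidity : Prop :=
  ∀ U : ℝ, 1 < U → ∀ μZ : Measure ℝ, IsSpectralMeasure zetaC μZ →
    ∃ S : Set (Measure ℝ), S ⊆ AnalyticBLExt U μZ ∧ ¬ S.Countable ∧ μZ ∉ S

/-- The weak form of F1-U: some analytic twin below depth `U` differs from `μZ`. (A `Prop`: statement
only; not a Literature fact.) -/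
def AnalyticNonRigidityWeak : Prop :=
  ∀ U : ℝ, 1 < U → ∀ μZ : Measure ℝ, IsSpectralMeasure zetaC μZ →
    ∃ μ ∈ AnalyticBLExt U μZ, μ ≠ μZ

/-! ## Structural lemmas (PROVED) -/

/-- The uncountable form implies the weak form. [folklore] -/
theorem analyticNonRigidityWeak_of_analyticNonRigidity (h : AnalyticNonRigidity) :
    AnalyticNonRigidityWeak := by
  intro U hU μZ hZ
  obtain ⟨S, hS, hSc, hZS⟩ := h U hU μZ hZ
  have hne : S.Nonempty := by
    by_contra hS0
    exact hSc (Set.not_nonempty_iff_eq_empty.mp hS0 ▸ Set.countable_empty)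
  obtain ⟨μ, hμ⟩ := hne
  exact ⟨μ, hS hμ, fun h => hZS (h ▸ hμ)⟩

/-- A spectral measure is even and tempered. [folklore] -/
theorem isEvenTempered_of_isSpectralMeasure {F : ExplicitDatum} {μ : Measure ℝ}
    (h : IsSpectralMeasure F μ) : IsEvenTempered μ :=
  ⟨h.1, h.2.1⟩

/-- `μZ` is an analytic twin of itself at every depth. [folklore] -/
theorem self_mem_analyticBLExt {μZ : Measure ℝ} (hZ : IsSpectralMeasure zetaC μZ) (U : ℝ) :
    μZ ∈ AnalyticBLExt U μZ :=
  ⟨isEvenTempered_of_isSpectralMeasure hZ, fun g hg _ _ _ => ⟨(hZ.2.2 g hg).1, rfl⟩⟩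

/-- The smooth part of a `ζ`-dressed g-prime system is `ζ`'s. [folklore] -/
theorem beurlingDatum_smooth (g : ℕ → ℝ) (m : ℕ → ℕ) : (beurlingDatum g m).smooth = zetaC.smooth := rfl

/-- An honest-below-`U` g-prime system has `ζ`'s quadratic form on Weil tests `g` supported in `[-a, a]`
with `2a < log U` (the test `g ⋆ g̃` lives in `[-2a, 2a] ⊂ (−log U, log U)`). [folklore] -/
theorem quadratic_eq_of_honestBelow {g : ℕ → ℝ} {m : ℕ → ℕ} {U : ℝ}
    (hhon : HonestBelow (beurlingDatum g m) U) {φ : ℝ → ℂ} (hφ : IsWeilTest φ) {a : ℝ}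
    (ha : tsupport φ ⊆ Icc (-a) a) (h2a : 2 * a < Real.log U) :
    (beurlingDatum g m).quadratic φ = zetaC.quadratic φ := by
  have hk : HasCompactSupport (weilConv φ (weilReflect φ)) := (hφ.weilConv hφ.weilReflect).2
  have hsupp : tsupport (weilConv φ (weilReflect φ)) ⊆ Ioo (-Real.log U) (Real.log U) :=
    (tsupport_weilConv_weilReflect_subset hφ.2 ha).trans (Icc_subset_Ioo (by linarith) (by linarith))
  have hprime := hhon _ hk hsupp
  unfold ExplicitDatum.quadratic ExplicitDatum.functional
  rw [hprime, beurlingDatum_smooth]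

/-- **`BLExt U ⊆ AnalyticBLExt U μZ`**: granting a spectral measure `μZ` of `ζ`'s datum, every member of
BL-EXT(U) is an analytic twin of `μZ` below depth `U` — condition (i) of GAP F1-G-b″ is necessary.
[folklore] -/
theorem blExt_subset_analyticBLExt {μZ : Measure ℝ} (hZ : IsSpectralMeasure zetaC μZ) (U : ℝ) :
    BLExt U ⊆ AnalyticBLExt U μZ := by
  rintro μ ⟨g, m, -, -, hhon, hμ⟩
  refine ⟨isEvenTempered_of_isSpectralMeasure hμ, fun φ hφ a ha h2a => ?_⟩
  obtain ⟨hint, hq⟩ := hμ.2.2 φ hφ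
  obtain ⟨-, hqZ⟩ := hZ.2.2 φ hφ
  refine ⟨hint, Complex.ofReal_injective ?_⟩
  rw [← hq, ← hqZ]
  exact quadratic_eq_of_honestBelow hhon hφ ha h2a

/-- Had the analytic half been rigid (`AnalyticBLExt U μZ ⊆ {μZ}`), every member of BL-EXT(U) would be
`μZ` — the route to GAP F1-G-b″ that THEOREM F1-U closes off (FAKES §1.9.3 (1)). [folklore] -/
theorem blExt_subset_singleton_of_analytic {μZ : Measure ℝ} (hZ : IsSpectralMeasure zetaC μZ) {U : ℝ}
    (hrig : AnalyticBLExt U μZ ⊆ {μZ}) : BLExt U ⊆ {μZ} :=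
  (blExt_subset_analyticBLExt hZ U).trans hrig

/-- F1-U, already in its weak form, says that this hypothesis fails at every depth `U > 1` for every
spectral measure of `ζ`'s datum. [folklore] -/
theorem not_analyticBLExt_subset_singleton (h : AnalyticNonRigidityWeak) {U : ℝ} (hU : 1 < U)
    {μZ : Measure ℝ} (hZ : IsSpectralMeasure zetaC μZ) : ¬ AnalyticBLExt U μZ ⊆ {μZ} := by
  intro hsub
  obtain ⟨μ, hμ, hne⟩ := h U hU μZ hZ
  exact hne (hsub hμ)

/-- The analytic half is antitone in the depth (on `U > 0`). [folklore] -/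
theorem analyticBLExt_antitone {μZ : Measure ℝ} {U U' : ℝ} (hU : 0 < U) (hUU' : U ≤ U') :
    AnalyticBLExt U' μZ ⊆ AnalyticBLExt U μZ := by
  rintro μ ⟨hev, htwin⟩
  refine ⟨hev, fun φ hφ a ha h2a => htwin φ hφ a ha (h2a.trans_le (Real.log_le_log hU hUU'))⟩

/-- **CONVEXITY of the analytic half**: a convex combination (finite weights `c + d = 1` in `ℝ≥0∞`) of
two analytic twins of `μZ` below depth `U` is an analytic twin of `μZ` below depth `U` (so, once two
members exist, a continuum does). [folklore] -/
theorem convexComb_mem_analyticBLExt {μZ μ₁ μ₂ : Measure ℝ} {U : ℝ} (h₁ : μ₁ ∈ AnalyticBLExt U μZ)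
    (h₂ : μ₂ ∈ AnalyticBLExt U μZ) {c d : ℝ≥0∞} (hc : c ≠ ⊤) (hd : d ≠ ⊤) (hcd : c + d = 1) :
    c • μ₁ + d • μ₂ ∈ AnalyticBLExt U μZ := by
  obtain ⟨⟨hev₁, C₁, N₁, hgr₁⟩, htw₁⟩ := h₁
  obtain ⟨⟨hev₂, C₂, N₂, hgr₂⟩, htw₂⟩ := h₂
  have hC₁ : 0 ≤ C₁ := by
    have h := (hgr₁ 0 le_rfl).2
    rw [add_zero, Real.one_rpow, mul_one] at h
    exact ENNReal.toReal_nonneg.trans h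
  have hC₂ : 0 ≤ C₂ := by
    have h := (hgr₂ 0 le_rfl).2
    rw [add_zero, Real.one_rpow, mul_one] at h
    exact ENNReal.toReal_nonneg.trans h
  refine ⟨⟨?_, c.toReal * C₁ + d.toReal * C₂, max N₁ N₂, fun T hT => ?_⟩, fun φ hφ a ha h2a => ?_⟩
  · rw [Measure.map_add _ _ measurable_neg, Measure.map_smul, Measure.map_smul, hev₁, hev₂]
  · obtain ⟨h1t, h1⟩ := hgr₁ T hT
    obtain ⟨h2t, h2⟩ := hgr₂ T hT
    have hpow₁ : (1 + T) ^ N₁ ≤ (1 + T) ^ max N₁ N₂ :=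
      Real.rpow_le_rpow_of_exponent_le (by linarith) (le_max_left _ _)
    have hpow₂ : (1 + T) ^ N₂ ≤ (1 + T) ^ max N₁ N₂ :=
      Real.rpow_le_rpow_of_exponent_le (by linarith) (le_max_right _ _)
    rw [Measure.add_apply, Measure.smul_apply, Measure.smul_apply, smul_eq_mul, smul_eq_mul]
    refine ⟨ENNReal.add_ne_top.2 ⟨ENNReal.mul_ne_top hc h1t, ENNReal.mul_ne_top hd h2t⟩, ?_⟩
    rw [ENNReal.toReal_add (ENNReal.mul_ne_top hc h1t) (ENNReal.mul_ne_top hd h2t),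
      ENNReal.toReal_mul, ENNReal.toReal_mul]
    calc c.toReal * (μ₁ (Icc (-T) T)).toReal + d.toReal * (μ₂ (Icc (-T) T)).toReal
        ≤ c.toReal * (C₁ * (1 + T) ^ max N₁ N₂) + d.toReal * (C₂ * (1 + T) ^ max N₁ N₂) :=
          add_le_add
            (mul_le_mul_of_nonneg_left (h1.trans (mul_le_mul_of_nonneg_left hpow₁ hC₁))
              ENNReal.toReal_nonneg)
            (mul_le_mul_of_nonneg_left (h2.trans (mul_le_mul_of_nonneg_left hpow₂ hC₂))
              ENNReal.toReal_nonneg)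
      _ = (c.toReal * C₁ + d.toReal * C₂) * (1 + T) ^ max N₁ N₂ := by ring
  · obtain ⟨hi₁, he₁⟩ := htw₁ φ hφ a ha h2a
    obtain ⟨hi₂, he₂⟩ := htw₂ φ hφ a ha h2a
    refine ⟨(hi₁.smul_measure hc).add_measure (hi₂.smul_measure hd), ?_⟩
    rw [integral_add_measure (hi₁.smul_measure hc) (hi₂.smul_measure hd), integral_smul_measure,
      integral_smul_measure, he₁, he₂, ← add_smul, ← ENNReal.toReal_add hc hd, hcd, ENNReal.toReal_one,
      one_smul]

/-- At depths `0 ≤ U ≤ 1` the twin condition is vacuous: every even tempered measure is an analytic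
twin of `μZ` (a test with `tsupport ⊆ [-a, a]`, `2a < log U ≤ 0`, is the zero test). [folklore] -/
theorem mem_analyticBLExt_of_le_one {μZ μ : Measure ℝ} (hμ : IsEvenTempered μ) {U : ℝ} (hU0 : 0 ≤ U)
    (hU1 : U ≤ 1) : μ ∈ AnalyticBLExt U μZ := by
  refine ⟨hμ, fun φ hφ a ha h2a => ?_⟩
  have hlog : Real.log U ≤ 0 := Real.log_nonpos hU0 hU1
  have ha0 : a < 0 := by linarith
  have hφ0 : φ = 0 := by
    funext x
    refine image_eq_zero_of_notMem_tsupport fun hx => ?_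
    have := ha hx
    simp only [mem_Icc] at this
    linarith [this.1, this.2]
  subst hφ0
  have h0 : (fun t : ℝ => ‖weilMellin (0 : ℝ → ℂ) (1 / 2 + t * I)‖ ^ 2) = fun _ => 0 := by
    funext t
    simp [weilMellin]
  rw [h0]
  exact ⟨integrable_zero _ _ _, by simp⟩

end Summit.RiemannHypothesis.RiemannHypothesis.Theorems.PfPersistence.Fake1.AnalyticTwin
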